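import Literature.MathematicalPhysics.QuantumLattice.HubbardSzSectorLadder
import HarnessLib

/-!
# The `(N↑, N↓)` sector is spanned by its configurations — a frame spans the sector iff it
reaches every configuration vector

Elementary linear algebra (Horn–Johnson, *Matrix Analysis* (2013) §0.2.7: `Φ y` is a linear
combination of the columns of `Φ`, so `range Φ` contains a coordinate subspace as soon as it
contains each of its standard basis vectors) applied to the coordinate sectors of the Hubbard
Fock space (Lieb, PRL **62** (1989) 1201, eq. (2) and proof of Theorem 1: the joint sector
`(N, S^z) = (a + b, (a - b)/2)` is the span of the occupation-number configurations `|α↑ ∪ β↓⟩`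
with `|α| = a`, `|β| = b` — `mem_szSector_iff_isInSector`).

Use (finite-size certification, e.g. symmetry-adapted / orbit-sum frames `Φ` of an exact-
diagonalisation sector): the hypothesis "the frame `Φ` spans the sector" of a sector-block
certificate is discharged by a family of SMALL exact identities `Φ *ᵥ w s = e_s`, one per
configuration `s` of the sector (each involving only the frame columns supported on the symmetry
orbit of `s`), instead of a dimension count.

## Contents

* `exists_mulVec_eq_of_single_certs` — generic: if `Φ *ᵥ w s = Pi.single s 1` for every `s` with
  `S s`, then every `v` vanishing off `S` is `Φ *ᵥ y` for some `y`.
* `IsInSector.exists_mulVec_eq_of_config_certs`, `exists_mulVec_eq_of_config_certs_of_mem_szSector`,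
  `exists_mulVec_eq_of_config_certs_of_mem_szSector_two_mul_zero` — the sector versions
  (`IsInSector a b`, `szSector (a + b) ((a - b)/2)`, `szSector (2 n) 0`).
-/

namespace Literature.MathematicalPhysics.QuantumLattice

open Matrix Finset HubbardWave0
open scoped ComplexOrder

section Generic

variable {ι κ R : Type*} [Fintype ι] [DecidableEq ι] [Fintype κ] [CommSemiring R]

/-- **Column-space criterion on a coordinate subspace.** If every standard basis vector `e_s`,
`s ∈ S`, is `Φ *ᵥ w s` for an explicit coefficient vector `w s`, then every vector supported on `S`
lies in the range of `Φ`: `v = Φ *ᵥ (∑ s, v s • w s)`.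
Horn–Johnson (2013) §0.2.7 (the range of `Φ` is its column space). [cite: HornJohnson2013, §0.2.7] -/
theorem exists_mulVec_eq_of_single_certs (Φ : Matrix ι κ R) (S : ι → Prop) (w : ι → κ → R)
    (hw : ∀ s, S s → Φ *ᵥ w s = Pi.single s 1) (v : ι → R) (hv : ∀ s, ¬ S s → v s = 0) :
    ∃ y : κ → R, Φ *ᵥ y = v := by
  classical
  refine ⟨∑ s, v s • w s, ?_⟩
  have hterm : ∀ s, Φ *ᵥ (v s • w s) = v s • (Pi.single s 1 : ι → R) := by
    intro s
    by_cases hs : S s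
    · rw [mulVec_smul, hw s hs]
    · rw [hv s hs, zero_smul, zero_smul, mulVec_zero]
  rw [mulVec_sum]
  simp_rw [hterm]
  ext j
  simp [Finset.sum_apply, Pi.single_apply]

end Generic

section Sector

variable {Λ : Type*} [LinearOrder Λ] [Fintype Λ] {κ : Type*} [Fintype κ]

/-- **The coordinate sector `(N↑, N↓) = (a, b)` is spanned by its configurations**, certificate
form: if the frame `Φ` reaches every configuration vector `e_s` with `|upPart s| = a`,
`|downPart s| = b` (`Φ *ᵥ w s = e_s`), then every `ψ` in the sector is `Φ *ᵥ y`.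
Lieb, PRL 62 (1989) 1201, eq. (2) / proof of Thm 1 (the sector is the span of the `|α↑ ∪ β↓⟩`);
Horn–Johnson (2013) §0.2.7. [cite: LiebPRL1989, eq. (2)] -/
theorem IsInSector.exists_mulVec_eq_of_config_certs {a b : ℕ}
    (Φ : Matrix (Finset (Orb Λ)) κ ℂ) (w : Finset (Orb Λ) → κ → ℂ)
    (hw : ∀ s, (upPart s).card = a ∧ (downPart s).card = b → Φ *ᵥ w s = Pi.single s 1)
    {ψ : Fock (Orb Λ)} (hψ : IsInSector a b ψ) : ∃ y : κ → ℂ, Φ *ᵥ y = ψ :=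
  exists_mulVec_eq_of_single_certs Φ (fun s => (upPart s).card = a ∧ (downPart s).card = b) w hw ψ
    hψ

/-- **The joint sector `(N, S^z) = (a + b, (a - b)/2)` is spanned by its configurations**,
certificate form (via `mem_szSector_iff_isInSector`).
Lieb, PRL 62 (1989) 1201, eq. (2); Horn–Johnson (2013) §0.2.7. [cite: LiebPRL1989, eq. (2)] -/
theorem exists_mulVec_eq_of_config_certs_of_mem_szSector (a b : ℕ)
    (Φ : Matrix (Finset (Orb Λ)) κ ℂ) (w : Finset (Orb Λ) → κ → ℂ)
    (hw : ∀ s, (upPart s).card = a ∧ (downPart s).card = b → Φ *ᵥ w s = Pi.single s 1) :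
    ∀ ψ ∈ szSector (Λ := Λ) (a + b) (((a : ℝ) - b) / 2), ∃ y : κ → ℂ, Φ *ᵥ y = ψ :=
  fun _ hψ =>
    IsInSector.exists_mulVec_eq_of_config_certs Φ w hw ((mem_szSector_iff_isInSector a b _).1 hψ)

/-- **The `S^z = 0` sector with `2n` electrons is spanned by its `(n, n)` configurations**,
certificate form — the shape of the `spans` hypothesis of an exact-diagonalisation sector-block
certificate (`szSector (2 n) 0`).
Lieb, PRL 62 (1989) 1201, eq. (2); Horn–Johnson (2013) §0.2.7. [cite: LiebPRL1989, eq. (2)] -/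
theorem exists_mulVec_eq_of_config_certs_of_mem_szSector_two_mul_zero (n : ℕ)
    (Φ : Matrix (Finset (Orb Λ)) κ ℂ) (w : Finset (Orb Λ) → κ → ℂ)
    (hw : ∀ s, (upPart s).card = n ∧ (downPart s).card = n → Φ *ᵥ w s = Pi.single s 1) :
    ∀ ψ ∈ szSector (Λ := Λ) (2 * n) 0, ∃ y : κ → ℂ, Φ *ᵥ y = ψ := by
  rw [szSector_two_mul_zero_eq n]
  exact exists_mulVec_eq_of_config_certs_of_mem_szSector n n Φ w hw

end Sector

end Literature.MathematicalPhysics.QuantumLattice
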